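import Summits.AtomisticToContinuum.Crystallization.Theorems.FrustratedLawDichotomyStrainedPatchHomEntryLeafHTA2QParts
import Summits.AtomisticToContinuum.Crystallization.Theorems.FrustratedLawDichotomyStrainedPatchHomEntryLeafHTA2QCentredRot
import Summits.AtomisticToContinuum.Crystallization.Theorems.FrustratedLawDichotomyStrainedPatchHomEntryLeafHTA2QCellXA1

/-!
# K1-v2 IN THE KERNEL at `cX95 × wX`, part 2: the remaining certificate pieces and ★★★ the assembled certificate side `htCertSideA2Q pXA2 QXA GnXA JX95 cX95 wX = true`
# (27623 `(H) HomFloor (1/625)`, hcp half; hand-1 g34 FINDING §3b)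

decomp-a2c hand-1 g34.  KERNEL: `restXA2` (`htCertRestA2`: ball / jac / straddlers / PSD confinement / curvature / far Jacobians / guards, ≈ 77 s), `linXA2`
(`g₀ + lin + ⌈√ΣQXA²⌉ + rem3 + nai ≤ GnXA`, ≈ 150 s), `farXA2` (`GnXA + far₁ + far₂ ≤ Gs`, ≈ 40 s); with `…CellXA1.qXA0/1/2`: ★★★ `htCertSideA2Q_XA2` by
`…HTA2QParts.htCertSideA2Q_of_parts`.

Kernel facts + assembly; 0 sorry; standard axioms.  `--supports stmt-AtomisticToContinuum-27623`.
-/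

namespace Summit.AtomisticToContinuum.Crystallization.Theorems.FrustratedLawDichotomyStrainedPatchHomEntryLeafHT

open Literature.Analysis.ValidatedNumerics.Numerics
open Summit.AtomisticToContinuum.Crystallization.Theorems.FrustratedLawDichotomyStrainedPatchHomCertTree (CertTree treeOK)
open Summit.AtomisticToContinuum.Crystallization.Theorems.FrustratedLawDichotomyStrainedPatchHomEntryTable (muRec)
open Summit.AtomisticToContinuum.Crystallization.Theorems.FrustratedLawDichotomyStrainedPatchHomEntryFitHcpCentred (entryLeafOKHQDCR)
open Summit.AtomisticToContinuum.Crystallization.Theorems.FrustratedLawDichotomyStrainedPatchHomSlopeLJ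
open Summit.AtomisticToContinuum.Crystallization.Theorems.FrustratedLawDichotomyStrainedPatchHomSlopeLJAffine
open Summit.AtomisticToContinuum.Crystallization.Theorems.FrustratedLawDichotomyStrainedPatchHomSlopeLJAffine2Kit

set_option maxRecDepth 100000 in
set_option maxHeartbeats 4000000 in
/-- ★ KERNEL: the non-slope conjuncts of the certificate side (`≈ 77 s`). -/
theorem restXA2 : htCertRestA2 pXA2 JX95 cX95 wX = true := by
  decide +kernel

set_option maxRecDepth 100000 in
set_option maxHeartbeats 4000000 in
/-- ★ KERNEL: centre force + first-order (J-combined) + `⌈√ΣQ²⌉` + third-order remainder + naive labels ≤ the near bound. -/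
theorem linXA2 : g0LJ cX95 (htScA2F cX95 wX JX95 (htNearU cX95 wX)) + linLJA cX95 wX JX95 (htScA2F cX95 wX JX95 (htNearU cX95 wX)) + sqrtQ QXA + rem3LJ cX95 (hullW JX95 wX) (htScA2F cX95 wX JX95 (htNearU cX95 wX)) +
    naiSLJ cX95 (hullW JX95 wX) (htSnA2F cX95 wX JX95 (htNearU cX95 wX)) ≤ GnXA := by
  decide +kernel

set_option maxRecDepth 100000 in
set_option maxHeartbeats 4000000 in
/-- KERNEL: near bound + the two all-naive far chunks ≤ `Gs`. -/
theorem farXA2 : GnXA + htGsNA cX95 wX JX95 (htFar1U cX95 wX) + htGsNA cX95 wX JX95 (htFar2U cX95 wX) ≤ pXA2.Gs := by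
  decide +kernel

/-- ★★★ **THE SECOND-ORDER AFFINE CERTIFICATE SIDE OF THE `0.95 t_b` CROSSOVER CELL HOLDS** (six kernel facts). [assembly] -/
theorem htCertSideA2Q_XA2 : htCertSideA2Q pXA2 QXA GnXA JX95 cX95 wX = true :=
  htCertSideA2Q_of_parts restXA2 qXA0 qXA1 qXA2 linXA2 farXA2

end Summit.AtomisticToContinuum.Crystallization.Theorems.FrustratedLawDichotomyStrainedPatchHomEntryLeafHT
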